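import Summits.QuantumFields.BalabanUV.Beta.CombWilsonT2Periodised
import Summits.QuantumFields.BalabanUV.Beta.PeriodisedIndexLawSummable

/-!
# `BalabanUV.Beta.CombHId1Letters` — binder row D1 (OWNER an2), (J-a) dictionary, item (C2) of TID § F.10 (L2′), generic part: **THE PERIODISED CHAIN-RULE
# VERTEX IS THE TORUS-COLUMN-WEIGHTED SUM OF THE PERIODISED TABLES** — for a packed kernel `K` invariant under the period lattice and decaying, and a
# period-covariant, bond-localised table family `S`: `dper M (vertexOfK K N S μ y) = Σ_{b ∈ box × Fin} perZ M K b (N•y) (inl b.2) (inr μ) • dper M (S b)`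

WHY.  The (STEP) door's `hId₁` row at the (III′) literal is, by leaf-05 g29's `CoarseJetOrderOneGradedComb.torus_hId₁_iff_graded_comb`, the sandwich
`−(Θᴸ·H₁·Θ) − Ŝ·Q₁₁·Θ − Θᴸ·Q₁₁ᵀ·Ŝ = c • H′₁` with `Θ` the `μ`-column block of the minimiser = the (ff-row, multiplier-column) entries of `perF M (GcombSh Lc j)`
(`RelInvPeriodisedCombMinOp.torus_minOp_submatrix_inl_comb`).  The dictionary must show its left side IS `c •` the periodised E-sector of member `j+1` along the
coarse direction `h̄` when the fine direction is `h = Θ·h̄` — the kernel identity `e3OfK N K S κ′ u′ = −mmRead N (K ∘ vertexOfK K N S κ′ u′ ∘ K)`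
(`ValueJetGeneric` :46) periodised.  Its first half is this file: the periodisation of an4's chain-rule vertex `vertexOfK K N S μ y =
Σ_{κ′} Σ'_u K u (N•y) (inl κ′) (inr μ) • S κ′ u` (`OneStepKernelFamily` :358) — the FAMILY INDEX runs over the whole lattice, and folding it onto the box turns the
column of `K` into the periodised column `perZ M K b (N•y)` = the torus column entry `(perF M K) ((b, inl κ′), (wrapPt (N•y), inr μ))`.

CONTENT ([folklore] Fubini for an ℓ¹ double family over OUR typed objects BY NAME; no `def`, no `def … : Prop`, nothing cited, 0 sorry):
§1 `wsum_apply'`, `vertexOfK_apply`, `perZ_eq_tsum_translate_left` (the period sum of a lattice-invariant kernel can be taken in the ROW point),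
`abs_perZ_le_of_decays`, `summable_of_translate_bound` (the 2D summability tool), `summable_col_mul_family`, **`dper_vertexOfK_eq_sum`**, `dper_family_translate`,
`abs_dper_family_le`, `vertexOfK_dper_apply`, **`dper_vertexOfK`** (periodisation COMMUTES with the vertex: `dper M (vertexOfK K N S μ y) = vertexOfK K N (κ u ↦ dper M (S κ u)) μ y`),
`perZ_coarse_col_eq_perF` (the weight is the torus column entry `(perF M K) ((u, inl κ′), (wrapPt M (N•y), inr μ))`), `periodCov_of_shiftK_cov` (bridge from the
literal's `(St)` covariance letter); §2 `nsmul_translate`, **`perF_mmRead_inl_inl(_eq_perF)`**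
(`M = N·M′`: the `mm`-read periodised on the coarse torus is the multiplier block of the fine torus matrix at the coarse points — re-indexing only).
NOT HERE: the sandwich exchange `dper M (K ∘ V ∘ K) = K ∘ dper M V ∘ K` ∕ `dper M′ ∘ e3OfK = e3OfK ∘ dper M` and its torus product form (`perF_comp`) — the sequel
`CombHId1Sandwich`; the instance at the record (`K := GcombSh Lc j`, leaf-05 g29's `torus_hId₁_iff_graded_comb` word) — `CombHId1Torus`.

HONEST DEPENDENCY (page 1, mandatory): continuum YM on T⁴ ⇐ BetaPertH ∧ nine spine estimates (0/9 proved); BetaPertH ⇐ (D1) ∧ (D4) ∧ CAP+tail;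
G-an2-4 gates asym, D1 and NE2/3/4.  HONEST FRAMING (cell contract, verbatim): «discharging `BetaPertH` makes Bałaban's UV stability UNCONDITIONAL —
a real constructive-QFT result; it is NOT the continuum limit and NOT the Clay problem.»  ABSOLUTE RULE (cell charter, verbatim): «No internally-minted
statement may enter as a cited fact. Every hypothesis is either kernel-proved in this package or a verbatim quotation of a PUBLISHED theorem with page
reference. The manuscript(s) under audit are NOT citable for their own disputed steps — they are the thing under adjudication; programme-internal
(2001/route/tribunal) claims are never citable.»  Row D1 OWNER an2 (b2b-balaban-beta-an2) gen 42, 2026-08-22.  No existing file touched.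
-/

noncomputable section

open scoped BigOperators

namespace Summit.QuantumFields.BalabanUV.Beta.CombHId1Letters

open Finset
open Literature.MathematicalPhysics.QuantumFieldTheory.Balaban1983to89
open Literature.MathematicalPhysics.QuantumFieldTheory.Balaban1983to89.Beta
open B12Sec2to5 (l1 l1_nonneg)
open B4TorusKernel.MultiPeriod (translate translate_apply)
open B4Reflection242 (translate_translate)
open B4Sect5Proof (latticeConst latticeConst_nonneg)
open B6Lemma24Torus (pbox)
open ExpKernelCalculus (MKer Decays BiLoc shiftK summable_exp_shift l1_sub_symm)
open AffineAveraging (Site)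
open OneStepResolventKernel (Fib wsum)
open OneStepKernelFamily (colH vertexOfK)
open Summit.QuantumFields.BalabanUV.Beta.FP.KernelPeriodisationFib (Idx perF perF_apply perZ perZ_apply perZ_translate_left perZ_translate_right
  translate_eq_add)
open Summit.QuantumFields.BalabanUV.Beta.FP.KernelPeriodisationFibLoc (dper dper_apply summable_exp_l1_translate)
open Summit.QuantumFields.BalabanUV.Beta.FP.KernelPeriodisationFibTrace (tsum_sites_eq_sum_tsum)
open Summit.QuantumFields.BalabanUV.Beta.FP.TorusGaugeCovariancePairing (wrapPt wrapPt_coe)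
open Summit.QuantumFields.BalabanUV.Beta.CombWilsonT2Periodised (dper_apply_of_periodCov)
open Summit.QuantumFields.BalabanUV.Beta.PeriodisedIndexLawSummable (abs_apply_le_of_biLoc)

variable {d : ℕ} (M : Fin (d + 1) → ℕ) [∀ μ, NeZero (M μ)] {N : ℕ}
  {K : MKer (d + 1) (Fib d)} {S : Fin (d + 1) → Site (d + 1) → MKer (d + 1) (Fib d)}

omit [∀ μ, NeZero (M μ)] in
/-- [folklore] `wsum` read pointwise. -/
theorem wsum_apply' (w : Site (d + 1) → ℝ) (F : Site (d + 1) → MKer (d + 1) (Fib d)) (x z : Site (d + 1)) (a b : Fib d) :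
    wsum w F x z a b = ∑' u : Site (d + 1), w u * F u x z a b := rfl

omit [∀ μ, NeZero (M μ)] in
/-- [folklore] an4's chain-rule vertex read pointwise: `vertexOfK K N S μ y x z a b = Σ_{κ′} Σ'_u K u (N•y) (inl κ′) (inr μ) · S κ′ u x z a b`. -/
theorem vertexOfK_apply (K : MKer (d + 1) (Fib d)) (N : ℕ) (S : Fin (d + 1) → Site (d + 1) → MKer (d + 1) (Fib d))
    (μ : Fin (d + 1)) (y x z : Site (d + 1)) (a b : Fib d) :
    vertexOfK K N S μ y x z a b = ∑ κ' : Fin (d + 1), ∑' u : Site (d + 1), K u ((N : ℤ) • y) (Sum.inl κ') (Sum.inr μ) * S κ' u x z a b := rfl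

omit [∀ μ, NeZero (M μ)] in
/-- [folklore] **for a kernel invariant under the period lattice the period sum may be taken in the ROW point**:
`perZ M K u y′ a b = Σ'_n K (u + M∘n) y′ a b` (`perZ` sums the column point; re-index `m ↦ −n`). -/
theorem perZ_eq_tsum_translate_left (hKinv : ∀ (m x z : Site (d + 1)) (a b : Fib d), K (translate M x m) (translate M z m) a b = K x z a b)
    (u y' : Site (d + 1)) (a b : Fib d) :
    perZ M K u y' a b = ∑' n : Site (d + 1), K (translate M u n) y' a b := by
  rw [perZ_apply, ← (Equiv.neg (Site (d + 1))).tsum_eq fun n => K (translate M u n) y' a b]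
  refine tsum_congr fun m => ?_
  have h := hKinv m (translate M u (-m)) y' a b
  rw [translate_translate, neg_add_cancel] at h
  have h0 : translate M u 0 = u := by funext i; rw [translate_apply, Pi.zero_apply, mul_zero, add_zero]
  rw [h0] at h
  exact h

/-- [folklore] the period sum of a decaying kernel is bounded: `|perZ M K u y′ a b| ≤ C·K_{d+1}(δ)`. -/
theorem abs_perZ_le_of_decays {C δ : ℝ} (hK : Decays K C δ) (hC : 0 ≤ C) (hδ : 0 < δ) (u y' : Site (d + 1)) (a b : Fib d) :
    |perZ M K u y' a b| ≤ C * latticeConst (d + 1) δ := by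
  obtain ⟨hs, hle⟩ := summable_exp_l1_translate M hδ u y'
  have h1 : ‖∑' m : Site (d + 1), K u (translate M y' m) a b‖ ≤ ∑' m : Site (d + 1), C * Real.exp (-δ * l1 (translate M y' m - u)) :=
    tsum_of_norm_bounded (hs.mul_left C).hasSum fun m => by
      rw [Real.norm_eq_abs, l1_sub_symm]; exact hK u (translate M y' m) a b
  rw [tsum_mul_left] at h1
  rw [perZ_apply]
  exact ((Real.norm_eq_abs _).symm.trans_le h1).trans (mul_le_mul_of_nonneg_left hle hC)

/-- [folklore] **THE 2D SUMMABILITY TOOL** (re-used by the sequel's sandwich exchanges): a family on `ℤ^{d+1} × ℤ^{d+1}` dominated by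
`C·e^{−α|y + M∘n − p|₁}·e^{−β|q − y|₁}` is absolutely summable (row sums over the period lattice `≤ C·K_{d+1}(α)` uniformly, then the decay in `y`). -/
theorem summable_of_translate_bound {C α β : ℝ} (hC : 0 ≤ C) (hα : 0 < α) (hβ : 0 < β) (p q : Site (d + 1))
    {f : Site (d + 1) × Site (d + 1) → ℝ}
    (hf : ∀ y n : Site (d + 1), |f (y, n)| ≤ C * Real.exp (-α * l1 (translate M y n - p)) * Real.exp (-β * l1 (q - y))) :
    Summable f := by
  have h0 : ∀ z : Site (d + 1) × Site (d + 1), 0 ≤ C * Real.exp (-α * l1 (translate M z.1 z.2 - p)) * Real.exp (-β * l1 (q - z.1)) :=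
    fun z => mul_nonneg (mul_nonneg hC (Real.exp_pos _).le) (Real.exp_pos _).le
  have hrow : ∀ y : Site (d + 1),
      (∑' n : Site (d + 1), C * Real.exp (-α * l1 (translate M y n - p)) * Real.exp (-β * l1 (q - y)))
        ≤ C * latticeConst (d + 1) α * Real.exp (-β * l1 (q - y)) := fun y => by
    rw [tsum_mul_right, tsum_mul_left]
    exact mul_le_mul_of_nonneg_right (mul_le_mul_of_nonneg_left (summable_exp_l1_translate M hα p y).2 hC) (Real.exp_pos _).le
  have hmaj : Summable fun z : Site (d + 1) × Site (d + 1) =>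
      C * Real.exp (-α * l1 (translate M z.1 z.2 - p)) * Real.exp (-β * l1 (q - z.1)) := by
    refine (summable_prod_of_nonneg h0).2 ⟨fun y => ?_, ?_⟩
    · exact ((summable_exp_l1_translate M hα p y).1.mul_left C).mul_right (Real.exp (-β * l1 (q - y)))
    · exact ((summable_exp_shift hβ q).mul_left (C * latticeConst (d + 1) α)).of_nonneg_of_le
        (fun y => tsum_nonneg fun n => h0 (y, n)) hrow
  refine hmaj.of_norm_bounded ?_
  rintro ⟨y, n⟩
  rw [Real.norm_eq_abs]
  exact hf y n

/-- [folklore] **THE 2D SUMMABILITY**: `(u, n) ↦ K (u + M∘n) (N•y) (inl κ′) (inr μ) · S κ′ u x z a b` is absolutely summable on `ℤ^{d+1} × ℤ^{d+1}`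
(the column decays from `N•y`, the table decays from its bond). -/
theorem summable_col_mul_family {CK δK CS δS : ℝ} (hK : Decays K CK δK) (hCK : 0 ≤ CK) (hδK : 0 < δK)
    (hS : ∀ κ u, BiLoc (S κ u) u u CS δS) (hCS : 0 ≤ CS) (hδS : 0 < δS)
    (κ' μ : Fin (d + 1)) (y x z : Site (d + 1)) (a b : Fib d) :
    Summable (Function.uncurry fun u n : Site (d + 1) =>
      K (translate M u n) ((N : ℤ) • y) (Sum.inl κ') (Sum.inr μ) * S κ' u x z a b) := by
  have hSu := abs_apply_le_of_biLoc S a b hS hCS hδS.le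
  refine summable_of_translate_bound M (mul_nonneg hCK hCS) hδK hδS ((N : ℤ) • y) x fun u n => ?_
  rw [Function.uncurry_apply_pair, abs_mul, show CK * CS * Real.exp (-δK * l1 (translate M u n - (N : ℤ) • y)) * Real.exp (-δS * l1 (x - u))
    = (CK * Real.exp (-δK * l1 (translate M u n - (N : ℤ) • y))) * (CS * Real.exp (-δS * l1 (x - u))) by ring]
  exact mul_le_mul (hK (translate M u n) _ _ _) (hSu κ' u x z) (abs_nonneg _) (mul_nonneg hCK (Real.exp_pos _).le)

/-- [folklore] **`dper_vertexOfK_eq_sum` — THE PERIODISED CHAIN-RULE VERTEX IS THE TORUS-COLUMN-WEIGHTED SUM OF THE PERIODISED TABLES.**  For `K` invariant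
under the period lattice of the box and decaying, `S` period-covariant and bond-localised:
`dper M (vertexOfK K N S μ y) x z a b = Σ_{u ∈ pbox M} Σ_{κ′} perZ M K u (N•y) (inl κ′) (inr μ) · dper M (S κ′ u) x z a b`. -/
theorem dper_vertexOfK_eq_sum
    (hKinv : ∀ (m x z : Site (d + 1)) (a b : Fib d), K (translate M x m) (translate M z m) a b = K x z a b)
    {CK δK CS δS : ℝ} (hK : Decays K CK δK) (hCK : 0 ≤ CK) (hδK : 0 < δK)
    (hSt : ∀ (κ : Fin (d + 1)) (u m x z : Site (d + 1)) (a b : Fib d), S κ (translate M u m) (translate M x m) (translate M z m) a b = S κ u x z a b)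
    (hS : ∀ κ u, BiLoc (S κ u) u u CS δS) (hCS : 0 ≤ CS) (hδS : 0 < δS)
    (μ : Fin (d + 1)) (y x z : Site (d + 1)) (a b : Fib d) :
    dper M (vertexOfK K N S μ y) x z a b
      = ∑ u : ↥(pbox M), ∑ κ' : Fin (d + 1), perZ M K (u : Site (d + 1)) ((N : ℤ) • y) (Sum.inl κ') (Sum.inr μ) * dper M (S κ' (u : Site (d + 1))) x z a b := by
  have hSu := abs_apply_le_of_biLoc S a b hS hCS hδS.le
  -- Step 1: unfold and move the period translate from the fluctuation slots onto the family index (period covariance of `S`)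
  have h1 : ∀ (n : Site (d + 1)) (κ' : Fin (d + 1)),
      (∑' u : Site (d + 1), K u ((N : ℤ) • y) (Sum.inl κ') (Sum.inr μ) * S κ' u (translate M x n) (translate M z n) a b)
        = ∑' u : Site (d + 1), K (translate M u n) ((N : ℤ) • y) (Sum.inl κ') (Sum.inr μ) * S κ' u x z a b := fun n κ' => by
    rw [← (Equiv.addRight (fun i => (M i : ℤ) * n i)).tsum_eq
      (fun u => K u ((N : ℤ) • y) (Sum.inl κ') (Sum.inr μ) * S κ' u (translate M x n) (translate M z n) a b)]
    refine tsum_congr fun u => ?_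
    have e : (Equiv.addRight (fun i => (M i : ℤ) * n i)) u = translate M u n := by
      rw [Equiv.coe_addRight, translate_eq_add]
    rw [e, hSt κ' u n x z a b]
  -- Step 2: Fubini over (u, n) for each κ′, and the column's period sum
  have h2 : ∀ κ' : Fin (d + 1),
      (∑' n : Site (d + 1), ∑' u : Site (d + 1), K (translate M u n) ((N : ℤ) • y) (Sum.inl κ') (Sum.inr μ) * S κ' u x z a b)
        = ∑' u : Site (d + 1), perZ M K u ((N : ℤ) • y) (Sum.inl κ') (Sum.inr μ) * S κ' u x z a b := fun κ' => by
    have hsum := summable_col_mul_family M (N := N) hK hCK hδK hS hCS hδS κ' μ y x z a b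
    rw [hsum.tsum_comm]
    refine tsum_congr fun u => ?_
    rw [perZ_eq_tsum_translate_left M hKinv, ← tsum_mul_right]
  -- Step 3: fold the family index onto the box (the weight `perZ` is periodic in `u`, `dper` sums the copies of `S`)
  have hper : ∀ (κ' : Fin (d + 1)) (u : Site (d + 1)) (m : Site (d + 1)),
      perZ M K (translate M u m) ((N : ℤ) • y) (Sum.inl κ') (Sum.inr μ) = perZ M K u ((N : ℤ) • y) (Sum.inl κ') (Sum.inr μ) := fun κ' u m =>
    perZ_translate_left M hKinv u _ m _ _
  have h3 : ∀ κ' : Fin (d + 1),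
      (∑' u : Site (d + 1), perZ M K u ((N : ℤ) • y) (Sum.inl κ') (Sum.inr μ) * S κ' u x z a b)
        = ∑ u : ↥(pbox M), perZ M K (u : Site (d + 1)) ((N : ℤ) • y) (Sum.inl κ') (Sum.inr μ) * dper M (S κ' (u : Site (d + 1))) x z a b := fun κ' => by
    have hG : Summable fun u : Site (d + 1) => perZ M K u ((N : ℤ) • y) (Sum.inl κ') (Sum.inr μ) * S κ' u x z a b := by
      refine ((summable_exp_shift hδS x).mul_left (CK * latticeConst (d + 1) δK * CS)).of_norm_bounded fun u => ?_
      rw [Real.norm_eq_abs, abs_mul, show CK * latticeConst (d + 1) δK * CS * Real.exp (-δS * l1 (x - u))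
        = (CK * latticeConst (d + 1) δK) * (CS * Real.exp (-δS * l1 (x - u))) by ring]
      exact mul_le_mul (abs_perZ_le_of_decays M hK hCK hδK u _ _ _) (hSu κ' u x z) (abs_nonneg _)
        (mul_nonneg hCK (latticeConst_nonneg _ hδK.le))
    rw [tsum_sites_eq_sum_tsum M hG]
    refine Finset.sum_congr rfl fun u _ => ?_
    simp only [hper]
    rw [tsum_mul_left, dper_apply_of_periodCov S hSt κ' (u : Site (d + 1)) x z a b]
  -- assemble
  rw [dper_apply]
  simp only [vertexOfK_apply, h1]
  have hn : ∀ κ' ∈ (Finset.univ : Finset (Fin (d + 1))), Summable fun n : Site (d + 1) =>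
      ∑' u : Site (d + 1), K (translate M u n) ((N : ℤ) • y) (Sum.inl κ') (Sum.inr μ) * S κ' u x z a b := fun κ' _ =>
    (summable_col_mul_family M (N := N) hK hCK hδK hS hCS hδS κ' μ y x z a b).prod_symm.prod
  rw [Summable.tsum_finsetSum hn]
  simp only [h2, h3]
  rw [Finset.sum_comm]

omit [∀ μ, NeZero (M μ)] in
/-- [folklore] the diagonal periodisation of a period-covariant family does not see which copy of the bond is named:
`dper M (S κ (u + M∘m)) x z a b = dper M (S κ u) x z a b`. -/
theorem dper_family_translate
    (hSt : ∀ (κ : Fin (d + 1)) (u m x z : Site (d + 1)) (a b : Fib d), S κ (translate M u m) (translate M x m) (translate M z m) a b = S κ u x z a b)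
    (κ : Fin (d + 1)) (u m x z : Site (d + 1)) (a b : Fib d) :
    dper M (S κ (translate M u m)) x z a b = dper M (S κ u) x z a b := by
  rw [dper_apply_of_periodCov S hSt, dper_apply_of_periodCov S hSt,
    ← (Equiv.addRight m).tsum_eq fun n => S κ (translate M u n) x z a b]
  refine tsum_congr fun n => ?_
  rw [Equiv.coe_addRight, translate_translate, add_comm]

/-- [folklore] the diagonal periodisation of a bond-localised, period-covariant family is bounded: `|dper M (S κ u) x z a b| ≤ C_S·K_{d+1}(δ_S)`. -/
theorem abs_dper_family_le {CS δS : ℝ}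
    (hSt : ∀ (κ : Fin (d + 1)) (u m x z : Site (d + 1)) (a b : Fib d), S κ (translate M u m) (translate M x m) (translate M z m) a b = S κ u x z a b)
    (hS : ∀ κ u, BiLoc (S κ u) u u CS δS) (hCS : 0 ≤ CS) (hδS : 0 < δS)
    (κ : Fin (d + 1)) (u x z : Site (d + 1)) (a b : Fib d) :
    |dper M (S κ u) x z a b| ≤ CS * latticeConst (d + 1) δS := by
  have hSu := abs_apply_le_of_biLoc S a b hS hCS hδS.le
  obtain ⟨hs, hle⟩ := summable_exp_l1_translate M hδS x u
  have h1 : ‖∑' m : Site (d + 1), S κ (translate M u m) x z a b‖ ≤ ∑' m : Site (d + 1), CS * Real.exp (-δS * l1 (translate M u m - x)) :=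
    tsum_of_norm_bounded (hs.mul_left CS).hasSum fun m => by
      rw [Real.norm_eq_abs, l1_sub_symm]; exact hSu κ (translate M u m) x z
  rw [tsum_mul_left] at h1
  rw [dper_apply_of_periodCov S hSt]
  exact ((Real.norm_eq_abs _).symm.trans_le h1).trans (mul_le_mul_of_nonneg_left hle hCS)

/-- [folklore] **THE CHAIN-RULE VERTEX OF THE PERIODISED FAMILY, READ ON THE BOX**:
`vertexOfK K N (κ u ↦ dper M (S κ u)) μ y x z a b = Σ_{u ∈ pbox M} Σ_{κ′} perZ M K u (N•y) (inl κ′) (inr μ) · dper M (S κ′ u) x z a b`. -/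
theorem vertexOfK_dper_apply
    (hKinv : ∀ (m x z : Site (d + 1)) (a b : Fib d), K (translate M x m) (translate M z m) a b = K x z a b)
    {CK δK CS δS : ℝ} (hK : Decays K CK δK) (hδK : 0 < δK)
    (hSt : ∀ (κ : Fin (d + 1)) (u m x z : Site (d + 1)) (a b : Fib d), S κ (translate M u m) (translate M x m) (translate M z m) a b = S κ u x z a b)
    (hS : ∀ κ u, BiLoc (S κ u) u u CS δS) (hCS : 0 ≤ CS) (hδS : 0 < δS)
    (μ : Fin (d + 1)) (y x z : Site (d + 1)) (a b : Fib d) :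
    vertexOfK K N (fun κ u => dper M (S κ u)) μ y x z a b
      = ∑ u : ↥(pbox M), ∑ κ' : Fin (d + 1), perZ M K (u : Site (d + 1)) ((N : ℤ) • y) (Sum.inl κ') (Sum.inr μ) * dper M (S κ' (u : Site (d + 1))) x z a b := by
  rw [vertexOfK_apply, Finset.sum_comm]
  refine Finset.sum_congr rfl fun κ' _ => ?_
  have hG : Summable fun u : Site (d + 1) => K u ((N : ℤ) • y) (Sum.inl κ') (Sum.inr μ) * dper M (S κ' u) x z a b := by
    refine ((ExpKernelCalculus.summable_exp_shift' hδK ((N : ℤ) • y)).mul_left (CK * (CS * latticeConst (d + 1) δS))).of_norm_bounded fun u => ?_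
    rw [Real.norm_eq_abs, abs_mul, show CK * (CS * latticeConst (d + 1) δS) * Real.exp (-δK * l1 (u - (N : ℤ) • y))
      = (CK * Real.exp (-δK * l1 (u - (N : ℤ) • y))) * (CS * latticeConst (d + 1) δS) by ring]
    exact mul_le_mul (hK u _ _ _) (abs_dper_family_le M hSt hS hCS hδS κ' u x z a b) (abs_nonneg _)
      (mul_nonneg (hK.nonneg (Sum.inl κ')) (Real.exp_pos _).le)
  rw [tsum_sites_eq_sum_tsum M hG]
  refine Finset.sum_congr rfl fun u _ => ?_
  simp only [dper_family_translate M hSt]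
  rw [tsum_mul_right, perZ_eq_tsum_translate_left M hKinv]

/-- [folklore] **`dper_vertexOfK` — PERIODISATION COMMUTES WITH THE CHAIN-RULE VERTEX**: the diagonal periodisation of an4's vertex over the
lattice family `S` IS the vertex over the periodised family `κ u ↦ dper M (S κ u)` (both are the box sum of `dper_vertexOfK_eq_sum`). -/
theorem dper_vertexOfK
    (hKinv : ∀ (m x z : Site (d + 1)) (a b : Fib d), K (translate M x m) (translate M z m) a b = K x z a b)
    {CK δK CS δS : ℝ} (hK : Decays K CK δK) (hCK : 0 ≤ CK) (hδK : 0 < δK)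
    (hSt : ∀ (κ : Fin (d + 1)) (u m x z : Site (d + 1)) (a b : Fib d), S κ (translate M u m) (translate M x m) (translate M z m) a b = S κ u x z a b)
    (hS : ∀ κ u, BiLoc (S κ u) u u CS δS) (hCS : 0 ≤ CS) (hδS : 0 < δS) (μ : Fin (d + 1)) (y : Site (d + 1)) :
    dper M (vertexOfK K N S μ y) = vertexOfK K N (fun κ u => dper M (S κ u)) μ y := by
  funext x z a b
  rw [dper_vertexOfK_eq_sum M hKinv hK hCK hδK hSt hS hCS hδS, vertexOfK_dper_apply M hKinv hK hδK hSt hS hCS hδS]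

/-- [folklore] **THE TORUS READING**: the weight is the torus column entry of `K` — `perZ M K u (N•y) (inl κ′) (inr μ) = (perF M K) ((u, inl κ′), (wrapPt M (N•y), inr μ))`. -/
theorem perZ_coarse_col_eq_perF (u : ↥(pbox M)) (κ' μ : Fin (d + 1)) (y : Site (d + 1)) :
    perZ M K (u : Site (d + 1)) ((N : ℤ) • y) (Sum.inl κ') (Sum.inr μ)
      = perF M K (u, Sum.inl κ') (wrapPt M ((N : ℤ) • y), Sum.inr μ) := by
  rw [perF_apply, wrapPt_coe]
  conv_lhs => rw [← GAN24.KernelPeriodisation.translate_wrap_quo M ((N : ℤ) • y)]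
  rw [perZ_translate_right]

omit [∀ μ, NeZero (M μ)] in
/-- [folklore] **BRIDGE from the literal's covariance letter**: a family with an1 ∕ an2's `(St)` shape `S κ (u + N•t) = shiftK (−N•t) (S κ u)`
(`CombChartStepJets.JsB12CombSh0_S_translate`) is period-covariant in this file's sense on every box with `N ∣ M i`. -/
theorem periodCov_of_shiftK_cov (hS : ∀ (κ : Fin (d + 1)) (u t : Site (d + 1)), S κ (u + (N : ℤ) • t) = shiftK (-((N : ℤ) • t)) (S κ u))
    (hM : ∀ i, N ∣ M i) (κ : Fin (d + 1)) (u m x z : Site (d + 1)) (a b : Fib d) :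
    S κ (translate M u m) (translate M x m) (translate M z m) a b = S κ u x z a b := by
  choose c hc using hM
  have hv : (fun i => (M i : ℤ) * m i) = (N : ℤ) • fun i => (c i : ℤ) * m i := by
    funext i; simp only [Pi.smul_apply, smul_eq_mul, hc i, Nat.cast_mul]; ring
  rw [translate_eq_add, translate_eq_add, translate_eq_add, hv, hS κ u]
  show S κ u (x + (N : ℤ) • (fun i => (c i : ℤ) * m i) + -((N : ℤ) • fun i => (c i : ℤ) * m i))
    (z + (N : ℤ) • (fun i => (c i : ℤ) * m i) + -((N : ℤ) • fun i => (c i : ℤ) * m i)) a b = S κ u x z a b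
  rw [add_neg_cancel_right, add_neg_cancel_right]

/-! ## §2 The `mm`-read on the coarse torus IS the multiplier block of the fine torus matrix at the coarse points -/

/-- [folklore] `N • (y + M′∘n) = N•y + M∘n` when `M = N·M′`. -/
theorem nsmul_translate {M M' : Fin (d + 1) → ℕ} (hM : ∀ i, M i = N * M' i) (y n : Site (d + 1)) :
    (N : ℤ) • translate M' y n = translate M ((N : ℤ) • y) n := by
  funext i
  simp only [Pi.smul_apply, translate_apply, smul_eq_mul, hM i, Nat.cast_mul]
  ring

/-- [folklore] **THE `mm`-READ PERIODISED ON THE COARSE TORUS** (`M = N·M′`): `perF M′ (mmRead N X) ((y₁, inl m₁), (y₂, inl m₂)) =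
perZ M X (N•y₁) (N•y₂) (inr m₁) (inr m₂)` — pure re-indexing of the period sum, no summability needed. -/
theorem perF_mmRead_inl_inl {M M' : Fin (d + 1) → ℕ} [∀ μ, NeZero (M' μ)] (hM : ∀ i, M i = N * M' i)
    (X : MKer (d + 1) (Fib d)) (y₁ y₂ : ↥(pbox M')) (m₁ m₂ : Fin (d + 1)) :
    perF M' (BalabanStepJetsSucc.mmRead N X) (y₁, Sum.inl m₁) (y₂, Sum.inl m₂)
      = perZ M X ((N : ℤ) • (y₁ : Site (d + 1))) ((N : ℤ) • (y₂ : Site (d + 1))) (Sum.inr m₁) (Sum.inr m₂) := by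
  rw [perF_apply, perZ_apply, perZ_apply]
  refine tsum_congr fun n => ?_
  rw [BalabanStepJetsSucc.mmRead_inl_inl, nsmul_translate hM]

/-- [folklore] **… AND AS A TORUS ENTRY OF THE FINE MATRIX** (for `X` invariant under the fine period lattice): `perF M′ (mmRead N X) ((y₁, inl m₁), (y₂, inl m₂))
= perF M X ((wrapPt M (N•y₁), inr m₁), (wrapPt M (N•y₂), inr m₂))` — the multiplier–multiplier entry of the fine torus matrix at the coarse points. -/
theorem perF_mmRead_inl_inl_eq_perF {M M' : Fin (d + 1) → ℕ} [∀ μ, NeZero (M μ)] [∀ μ, NeZero (M' μ)] (hM : ∀ i, M i = N * M' i)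
    {X : MKer (d + 1) (Fib d)} (hXinv : ∀ (m x z : Site (d + 1)) (a b : Fib d), X (translate M x m) (translate M z m) a b = X x z a b)
    (y₁ y₂ : ↥(pbox M')) (m₁ m₂ : Fin (d + 1)) :
    perF M' (BalabanStepJetsSucc.mmRead N X) (y₁, Sum.inl m₁) (y₂, Sum.inl m₂)
      = perF M X (wrapPt M ((N : ℤ) • (y₁ : Site (d + 1))), Sum.inr m₁) (wrapPt M ((N : ℤ) • (y₂ : Site (d + 1))), Sum.inr m₂) := by
  rw [perF_mmRead_inl_inl hM, perF_apply, wrapPt_coe, wrapPt_coe]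
  conv_lhs => rw [← GAN24.KernelPeriodisation.translate_wrap_quo M ((N : ℤ) • (y₁ : Site (d + 1))),
    ← GAN24.KernelPeriodisation.translate_wrap_quo M ((N : ℤ) • (y₂ : Site (d + 1)))]
  rw [perZ_translate_right, perZ_translate_left M hXinv]

end Summit.QuantumFields.BalabanUV.Beta.CombHId1Letters

end
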